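import Mathlib
import Summits.MatrixMultiplication.MatrixMultiplication.Theses.HiddenToeplitzCorners
import Summits.MatrixMultiplication.MatrixMultiplication.Theorems.HiddenToeplitzCornersHiddenCornerLemmaRStein

/-!
# `HiddenToeplitzCorners.HiddenCorners` (stmt-MatrixMultiplication-7492) — Negative lane:
# degenerate parameter values are excluded by the statement as typed

Refuter crux-attack (one cycle, audit class REDUCTION), kernel-checked form of the vacuity / junk-value
audit of the crux `HiddenCorners` (∀ ε > 0, ∃ᶠ r, ∃ N d T G₀ H₀ G₁ H₁, split Stein identity ∧ sparsity ∧
(∃ X₀, det T(X₀) ≠ 0) ∧ (∀ X, det X = 0 → det T(X) = 0)).  No Theses statement is asserted positively.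

* `hiddenCorners_clause_iii_false_of_size_zero` — `N = 0` is NOT a loophole: for `r ≥ 1` the empty
  determinant is `1`, so clause (iii) fails at the singular matrix `X = 0`.
* `hiddenCorners_coeff_eq_zero_of_width_zero` — `d = 0` is NOT a loophole: with no generators the split
  Stein identity reads `T_ab = Z T_ab Zᵀ`, which forces `T_ab = 0` (Stein uniqueness for the nilpotent
  shift, tree lemma `hclR_eq_zero_of_stein`), so clause (ii) fails.
* `hiddenCorners_r_le_size` — the first genuine constraint every witness obeys: a pencil
  `T : M_r(ℂ) → M_N(ℂ)` that is nonsingular somewhere and singular on every singular `X` has `r ≤ N`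
  (degree count on the line `t ↦ X₀·diag(1 − t(j+1))`: `det T` restricted to it is a nonzero polynomial of
  degree `≤ N` with the `r` distinct roots `t = 1/(j+1)`).
* `hiddenCorners_witness_size_and_width` — packaged on the crux's own binders: every witness of the
  inner body has `r ≤ N` and `1 ≤ d` (for `r ≥ 1`).
* `hiddenCorners_body_at_eps_one`, `hiddenCorners_frequently_at_eps_one` — the TRIVIAL witness and where
  it stops: the identity pencil `T(X) = X` (`N = d = r`) satisfies the inner body at `ε = 1` for every
  `r ≥ 2`, so `HiddenCorners` with `ε` frozen at `1` is true; the clause `d ≤ r^ε` for `ε → 0` is the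
  whole content (and exactly what the law-of-ends programme denies).
-/

set_option linter.dupNamespace false

namespace Summit.MatrixMultiplication.MatrixMultiplication.Theorems

open scoped BigOperators Matrix
open Polynomial

/-- **`N = 0` is excluded.** For `r ≥ 1`, no pencil of `0 × 0` matrices is singular on the singular
matrix `X = 0`: the empty determinant is `1`. [folklore] -/
theorem hiddenCorners_clause_iii_false_of_size_zero {r : ℕ} (hr : 1 ≤ r)
    (T : Fin r → Fin r → Matrix (Fin 0) (Fin 0) ℂ) :
    ¬ ∀ X : Matrix (Fin r) (Fin r) ℂ, X.det = 0 →
        (∑ a : Fin r, ∑ b : Fin r, X a b • T a b).det = 0 := by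
  intro h
  haveI hne : Nonempty (Fin r) := ⟨⟨0, hr⟩⟩
  have h0 := h 0 Matrix.det_zero
  rw [Matrix.det_isEmpty] at h0
  exact one_ne_zero h0

/-- **`d = 0` is excluded.** With generators of width `0` the split Stein identity says
`T_ab − Z T_ab Zᵀ = 0`, and Stein uniqueness for the nilpotent lower shift forces `T_ab = 0`. [folklore] -/
theorem hiddenCorners_coeff_eq_zero_of_width_zero {r N : ℕ}
    (T : Fin r → Fin r → Matrix (Fin N) (Fin N) ℂ) (G₀ H₀ : Matrix (Fin N) (Fin 0) ℂ)
    (G₁ H₁ : Fin r → Fin r → Matrix (Fin N) (Fin 0) ℂ)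
    (hdisp : ∀ a b, T a b -
        (Matrix.of fun i j : Fin N => if (i : ℕ) = (j : ℕ) + 1 then (1 : ℂ) else 0) * T a b *
          (Matrix.of fun i j : Fin N => if (i : ℕ) = (j : ℕ) + 1 then (1 : ℂ) else 0)ᵀ =
        G₀ * (H₁ a b)ᵀ + G₁ a b * H₀ᵀ) (a b : Fin r) :
    T a b = 0 := by
  have h := hdisp a b
  have hG : G₀ * (H₁ a b)ᵀ = 0 := by
    ext i j; simp [Matrix.mul_apply]
  have hH : G₁ a b * H₀ᵀ = 0 := by
    ext i j; simp [Matrix.mul_apply]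
  rw [hG, hH, add_zero, sub_eq_zero] at h
  exact hclR_eq_zero_of_stein (T a b) h

/-- **Every witness has `r ≤ N`.** If a linear pencil `X ↦ Σ X_ab • T_ab` of `N × N` matrices is
nonsingular at some `X₀` and singular at every singular `X`, then `r ≤ N`.  Proof: along the line
`X(t) = X₀ · diag(1 − t(j+1))` the determinant is a polynomial in `t` of degree `≤ N`
(`Polynomial.natDegree_det_X_add_C_le`), nonzero at `t = 0`, and vanishing at the `r` distinct points
`t = 1/(j+1)`, where `X(t)` is singular. [folklore] -/
theorem hiddenCorners_r_le_size {r N : ℕ} (T : Fin r → Fin r → Matrix (Fin N) (Fin N) ℂ)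
    (hX₀ : ∃ X₀ : Matrix (Fin r) (Fin r) ℂ, (∑ a : Fin r, ∑ b : Fin r, X₀ a b • T a b).det ≠ 0)
    (hsing : ∀ X : Matrix (Fin r) (Fin r) ℂ, X.det = 0 →
        (∑ a : Fin r, ∑ b : Fin r, X a b • T a b).det = 0) :
    r ≤ N := by
  obtain ⟨X₀, hX₀⟩ := hX₀
  -- the two constant matrices of the line: `G = T(X₀)`, `A = T(−X₀·D)` with `D = diag(j+1)`
  set G : Matrix (Fin N) (Fin N) ℂ := ∑ a : Fin r, ∑ b : Fin r, X₀ a b • T a b with hG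
  set A : Matrix (Fin N) (Fin N) ℂ :=
    ∑ a : Fin r, ∑ b : Fin r, (-(X₀ a b * ((b : ℂ) + 1))) • T a b with hA
  set Q : ℂ[X] := Matrix.det ((X : ℂ[X]) • A.map C + G.map C) with hQ
  -- evaluation of `Q` at a scalar `t` is the pencil determinant at `X(t)`
  have heval : ∀ t : ℂ, Q.eval t =
      (∑ a : Fin r, ∑ b : Fin r, (X₀ a b * (1 - t * ((b : ℂ) + 1))) • T a b).det := by
    intro t
    have h1 : Q.eval t = (t • A + G).det := by
      rw [hQ, ← Polynomial.coe_evalRingHom, RingHom.map_det]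
      congr 1
      ext i j
      simp only [Matrix.add_apply, Matrix.smul_apply, Matrix.map_apply, RingHom.mapMatrix_apply,
        smul_eq_mul, Polynomial.coe_evalRingHom, Polynomial.eval_add, Polynomial.eval_mul,
        Polynomial.eval_X, Polynomial.eval_C]
    rw [h1]
    congr 1
    rw [hA, hG, Finset.smul_sum, ← Finset.sum_add_distrib]
    refine Finset.sum_congr rfl fun a _ => ?_
    rw [Finset.smul_sum, ← Finset.sum_add_distrib]
    refine Finset.sum_congr rfl fun b _ => ?_
    rw [smul_smul, ← add_smul]
    congr 1
    ring
  -- degree bound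
  have hdeg : Q.natDegree ≤ N := by
    have h := Polynomial.natDegree_det_X_add_C_le A G
    rwa [Fintype.card_fin] at h
  -- `Q` vanishes at the `r` distinct points `1/(j+1)`
  have hroot : ∀ j : Fin r, Q.eval (1 / ((j : ℂ) + 1)) = 0 := by
    intro j
    rw [heval]
    have hj : ((j : ℂ) + 1) ≠ 0 := Nat.cast_add_one_ne_zero (j : ℕ)
    set t : ℂ := 1 / ((j : ℂ) + 1) with ht
    have key : (∑ a : Fin r, ∑ b : Fin r, (X₀ a b * (1 - t * ((b : ℂ) + 1))) • T a b) =
        ∑ a : Fin r, ∑ b : Fin r,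
          (X₀ * Matrix.diagonal fun b : Fin r => (1 - t * ((b : ℂ) + 1))) a b • T a b := by
      refine Finset.sum_congr rfl fun a _ => Finset.sum_congr rfl fun b _ => ?_
      rw [Matrix.mul_diagonal]
    rw [key]
    apply hsing (X₀ * Matrix.diagonal fun b : Fin r => (1 - t * ((b : ℂ) + 1)))
    rw [Matrix.det_mul, Matrix.det_diagonal]
    apply mul_eq_zero_of_right
    apply Finset.prod_eq_zero (Finset.mem_univ j)
    rw [ht, one_div, inv_mul_cancel₀ hj, sub_self]
  -- if `N < r`, a polynomial of degree `≤ N` with `r` distinct roots vanishes identically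
  by_contra hlt
  have hlt' : N < r := Nat.lt_of_not_le hlt
  have hinj : Function.Injective fun j : Fin r => (1 : ℂ) / ((j : ℂ) + 1) := by
    intro j j' h
    have hj : ((j : ℂ) + 1) ≠ 0 := Nat.cast_add_one_ne_zero (j : ℕ)
    have hj' : ((j' : ℂ) + 1) ≠ 0 := Nat.cast_add_one_ne_zero (j' : ℕ)
    have h2 : ((j : ℂ) + 1) = ((j' : ℂ) + 1) := by
      have := congrArg (fun x : ℂ => x⁻¹) h
      simpa [one_div, inv_inv] using this
    have h3 : (j : ℕ) = (j' : ℕ) := by exact_mod_cast add_right_cancel h2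
    exact Fin.ext h3
  have hQ0 : Q = 0 :=
    Polynomial.eq_zero_of_natDegree_lt_card_of_eval_eq_zero Q hinj hroot
      (by rw [Fintype.card_fin]; omega)
  -- but `Q(0) = det T(X₀) ≠ 0`
  have h0 : Q.eval 0 = (∑ a : Fin r, ∑ b : Fin r, X₀ a b • T a b).det := by
    rw [heval]; simp
  rw [hQ0, Polynomial.eval_zero] at h0
  exact hX₀ h0.symm

/-- **Packaged on the crux's binders.** Every witness `(r, N, d, T, G₀, H₀, G₁, H₁)` of the inner body of
`HiddenCorners` with `r ≥ 1` has `r ≤ N` and `1 ≤ d`: neither the empty matrix nor the generator-free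
Stein identity is a loophole of the statement as typed. [folklore] -/
theorem hiddenCorners_witness_size_and_width {r N d : ℕ} (hr : 1 ≤ r)
    (T : Fin r → Fin r → Matrix (Fin N) (Fin N) ℂ) (G₀ H₀ : Matrix (Fin N) (Fin d) ℂ)
    (G₁ H₁ : Fin r → Fin r → Matrix (Fin N) (Fin d) ℂ)
    (hdisp : ∀ a b, T a b -
        (Matrix.of fun i j : Fin N => if (i : ℕ) = (j : ℕ) + 1 then (1 : ℂ) else 0) * T a b *
          (Matrix.of fun i j : Fin N => if (i : ℕ) = (j : ℕ) + 1 then (1 : ℂ) else 0)ᵀ =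
        G₀ * (H₁ a b)ᵀ + G₁ a b * H₀ᵀ)
    (hX₀ : ∃ X₀ : Matrix (Fin r) (Fin r) ℂ, (∑ a : Fin r, ∑ b : Fin r, X₀ a b • T a b).det ≠ 0)
    (hsing : ∀ X : Matrix (Fin r) (Fin r) ℂ, X.det = 0 →
        (∑ a : Fin r, ∑ b : Fin r, X a b • T a b).det = 0) :
    r ≤ N ∧ 1 ≤ d := by
  have hrN : r ≤ N := hiddenCorners_r_le_size T hX₀ hsing
  refine ⟨hrN, ?_⟩
  by_contra hd
  have hd0 : d = 0 := by omega
  subst hd0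
  have hT : ∀ a b, T a b = 0 := hiddenCorners_coeff_eq_zero_of_width_zero T G₀ H₀ G₁ H₁ hdisp
  obtain ⟨X₀, hX₀⟩ := hX₀
  apply hX₀
  haveI hne : Nonempty (Fin N) := ⟨⟨0, by omega⟩⟩
  simp [hT, Matrix.det_zero]

/-- The pencil of matrix units is the identity pencil: `Σ_ab X_ab • E_ab = X`. [folklore] -/
theorem hiddenCorners_sum_smul_single_eq {r : ℕ} (X : Matrix (Fin r) (Fin r) ℂ) :
    (∑ a : Fin r, ∑ b : Fin r, X a b • Matrix.single a b (1 : ℂ)) = X := by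
  simp_rw [Matrix.smul_single, smul_eq_mul, mul_one]
  exact (Matrix.matrix_eq_sum_single X).symm

/-- **The trivial witness and where it stops.** At `ε = 1` the inner body of `HiddenCorners` holds for
every `r ≥ 2`, witnessed by the identity pencil `T(X) = X` (`N = d = r`, `T_ab = E_ab`, split Stein
generators `G₀ = 1`, `H₁(a,b) = E_ba`, `G₁(a,b) = −Z E_ab`, `H₀ = Z`, generator sparsity `≤ 2r² ≤ r³`,
`det T(X) = det X`).  The same witness violates `d ≤ r^ε` for every `ε < 1`; the crux's content is
entirely the regime `ε → 0` (displacement width `r^{o(1)}`), cf. `hiddenCorners_witness_size_and_width`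
and the law-of-ends bridge in `Cruxes/HiddenCorners/LawOfEnds.lean`. [folklore] -/
theorem hiddenCorners_body_at_eps_one {r : ℕ} (hr : 2 ≤ r) :
    ∃ (N d : ℕ), (N : ℝ) ≤ (r : ℝ) ^ (2 + (1 : ℝ)) ∧ (d : ℝ) ≤ (r : ℝ) ^ (1 : ℝ) ∧
      ∃ (T : Fin r → Fin r → Matrix (Fin N) (Fin N) ℂ) (G₀ H₀ : Matrix (Fin N) (Fin d) ℂ)
        (G₁ H₁ : Fin r → Fin r → Matrix (Fin N) (Fin d) ℂ),
        (∀ a b, T a b -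
            (Matrix.of fun i j : Fin N => if (i : ℕ) = (j : ℕ) + 1 then (1 : ℂ) else 0) * T a b *
              (Matrix.of fun i j : Fin N => if (i : ℕ) = (j : ℕ) + 1 then (1 : ℂ) else 0)ᵀ =
            G₀ * (H₁ a b)ᵀ + G₁ a b * H₀ᵀ) ∧
        ((∑ a : Fin r, ∑ b : Fin r,
            ((Finset.univ.filter fun p : Fin N × Fin d => G₁ a b p.1 p.2 ≠ 0).card +
              (Finset.univ.filter fun p : Fin N × Fin d => H₁ a b p.1 p.2 ≠ 0).card) : ℕ) : ℝ) ≤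
            (r : ℝ) ^ (2 + (1 : ℝ)) ∧
        (∃ X₀ : Matrix (Fin r) (Fin r) ℂ, (∑ a : Fin r, ∑ b : Fin r, X₀ a b • T a b).det ≠ 0) ∧
        ∀ X : Matrix (Fin r) (Fin r) ℂ, X.det = 0 →
          (∑ a : Fin r, ∑ b : Fin r, X a b • T a b).det = 0 := by
  have h3 : (r : ℝ) ^ (2 + (1 : ℝ)) = ((r ^ 3 : ℕ) : ℝ) := by
    rw [show (2 : ℝ) + 1 = ((3 : ℕ) : ℝ) by norm_num, Real.rpow_natCast]
    push_cast; ring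
  refine ⟨r, r, ?_, ?_, ?_⟩
  · rw [h3]
    exact_mod_cast Nat.le_self_pow (by norm_num) r
  · rw [Real.rpow_one]
  · set Z : Matrix (Fin r) (Fin r) ℂ :=
      Matrix.of fun i j : Fin r => if (i : ℕ) = (j : ℕ) + 1 then (1 : ℂ) else 0 with hZ
    refine ⟨fun a b => Matrix.single a b 1, 1, Z, fun a b => -(Z * Matrix.single a b 1),
      fun a b => Matrix.single b a 1, ?_, ?_, ?_, ?_⟩
    · intro a b
      rw [Matrix.transpose_single, Matrix.one_mul, neg_mul, sub_eq_add_neg]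
    · -- generator sparsity: each `G₁(a,b) = -Z E_ab` and each `H₁(a,b) = E_ba` has at most one nonzero entry
      have hG : ∀ a b : Fin r,
          (Finset.univ.filter fun p : Fin r × Fin r => (-(Z * Matrix.single a b (1 : ℂ))) p.1 p.2 ≠ 0).card
            ≤ 1 := by
        intro a b
        refine Finset.card_le_one.mpr ?_
        intro p hp q hq
        simp only [Finset.mem_filter, Finset.mem_univ, true_and, Matrix.neg_apply, ne_eq,
          neg_eq_zero] at hp hq
        have key : ∀ s : Fin r × Fin r, (Z * Matrix.single a b (1 : ℂ)) s.1 s.2 ≠ 0 →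
            s.2 = b ∧ (s.1 : ℕ) = (a : ℕ) + 1 := by
          intro s hs
          have hs2 : s.2 = b := by
            by_contra hne
            exact hs (Matrix.mul_single_apply_of_ne (1 : ℂ) a b s.1 s.2 hne Z)
          refine ⟨hs2, ?_⟩
          rw [hs2, Matrix.mul_single_apply_same, mul_one, hZ, Matrix.of_apply] at hs
          by_contra hne
          exact hs (if_neg hne)
        obtain ⟨hp2, hp1⟩ := key p hp
        obtain ⟨hq2, hq1⟩ := key q hq
        exact Prod.ext (Fin.ext (by omega)) (by rw [hp2, hq2])
      have hH : ∀ a b : Fin r,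
          (Finset.univ.filter fun p : Fin r × Fin r => (Matrix.single b a (1 : ℂ)) p.1 p.2 ≠ 0).card
            ≤ 1 := by
        intro a b
        refine Finset.card_le_one.mpr ?_
        intro p hp q hq
        simp only [Finset.mem_filter, Finset.mem_univ, true_and, ne_eq] at hp hq
        have key : ∀ s : Fin r × Fin r, Matrix.single b a (1 : ℂ) s.1 s.2 ≠ 0 → s = (b, a) := by
          intro s hs
          by_contra hne
          apply hs
          apply Matrix.single_apply_of_ne
          rintro ⟨h1, h2⟩
          exact hne (Prod.ext h1.symm h2.symm)
        rw [key p hp, key q hq]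
      have hnat : (∑ a : Fin r, ∑ b : Fin r,
          ((Finset.univ.filter fun p : Fin r × Fin r =>
              (-(Z * Matrix.single a b (1 : ℂ))) p.1 p.2 ≠ 0).card +
            (Finset.univ.filter fun p : Fin r × Fin r =>
              (Matrix.single b a (1 : ℂ)) p.1 p.2 ≠ 0).card)) ≤ r ^ 3 := by
        calc (∑ a : Fin r, ∑ b : Fin r,
            ((Finset.univ.filter fun p : Fin r × Fin r =>
                (-(Z * Matrix.single a b (1 : ℂ))) p.1 p.2 ≠ 0).card +
              (Finset.univ.filter fun p : Fin r × Fin r =>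
                (Matrix.single b a (1 : ℂ)) p.1 p.2 ≠ 0).card))
            ≤ ∑ _a : Fin r, ∑ _b : Fin r, 2 := by
              refine Finset.sum_le_sum fun a _ => Finset.sum_le_sum fun b _ => ?_
              have := hG a b
              have := hH a b
              omega
          _ = 2 * r ^ 2 := by simp; ring
          _ ≤ r ^ 3 := by
              calc 2 * r ^ 2 ≤ r * r ^ 2 := Nat.mul_le_mul_right (r ^ 2) hr
                _ = r ^ 3 := by ring
      rw [h3]
      exact_mod_cast hnat
    · refine ⟨1, ?_⟩
      rw [hiddenCorners_sum_smul_single_eq]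
      simp
    · intro X hX
      rw [hiddenCorners_sum_smul_single_eq]
      exact hX

/-- **`HiddenCorners` with `ε` frozen at `1` is true** (the trivial witness, frequently — indeed eventually —
in `r`).  Recorded so that no seat mistakes the large-`ε` regime for content: the crux quantifies over
every `ε > 0`, and the assembly consumes it at `ε' = min(ε,1)/8`. [folklore] -/
theorem hiddenCorners_frequently_at_eps_one :
    ∃ᶠ r : ℕ in Filter.atTop, ∃ (N d : ℕ), (N : ℝ) ≤ (r : ℝ) ^ (2 + (1 : ℝ)) ∧
      (d : ℝ) ≤ (r : ℝ) ^ (1 : ℝ) ∧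
      ∃ (T : Fin r → Fin r → Matrix (Fin N) (Fin N) ℂ) (G₀ H₀ : Matrix (Fin N) (Fin d) ℂ)
        (G₁ H₁ : Fin r → Fin r → Matrix (Fin N) (Fin d) ℂ),
        (∀ a b, T a b -
            (Matrix.of fun i j : Fin N => if (i : ℕ) = (j : ℕ) + 1 then (1 : ℂ) else 0) * T a b *
              (Matrix.of fun i j : Fin N => if (i : ℕ) = (j : ℕ) + 1 then (1 : ℂ) else 0)ᵀ =
            G₀ * (H₁ a b)ᵀ + G₁ a b * H₀ᵀ) ∧
        ((∑ a : Fin r, ∑ b : Fin r,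
            ((Finset.univ.filter fun p : Fin N × Fin d => G₁ a b p.1 p.2 ≠ 0).card +
              (Finset.univ.filter fun p : Fin N × Fin d => H₁ a b p.1 p.2 ≠ 0).card) : ℕ) : ℝ) ≤
            (r : ℝ) ^ (2 + (1 : ℝ)) ∧
        (∃ X₀ : Matrix (Fin r) (Fin r) ℂ, (∑ a : Fin r, ∑ b : Fin r, X₀ a b • T a b).det ≠ 0) ∧
        ∀ X : Matrix (Fin r) (Fin r) ℂ, X.det = 0 →
          (∑ a : Fin r, ∑ b : Fin r, X a b • T a b).det = 0 :=
  ((Filter.eventually_ge_atTop 2).mono fun _ hr => hiddenCorners_body_at_eps_one hr).frequently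

end Summit.MatrixMultiplication.MatrixMultiplication.Theorems
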